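import Summits.BirchSwinnertonDyer.BirchSwinnertonDyer.Theorems.ByReductionTypeAtTwoRankOneAtTwoBigImageOddLocalOneDoorSubsliceFirstLayerManinFree
import Literature.NumberTheory.EllipticCurves.BSDSelmerSmithHigherSelmerRankLaws
import HarnessLib

/-!
# ES-45 — THE `Ш`-RESIDUE `R_S`: SPIN ONE STOREY UP (-es g36, Euler-system / explicit-reciprocity lens; crux 23715 `RankOneAtTwoBigImageOddLocal`)

WORKFILE of the cell `bsd-f1-sign2` (planner seat `-es`), written with `ledger crux write stmt-BirchSwinnertonDyer-23715 ShaSpinAtTwoES45.lean`.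
Nothing here is a tree theorem about BSD; the `@[conjecture]` items are the lens's typed candidates, the theorems are Selmer bookkeeping
and the kernel reduction of the RESTRICTED residue.  BSD is not proved by any of this.

VERSION v1.3 (-es g37, 2026-08-31T09:45Z): v1.2 (e70dac8a4fcab1bd, commit bc7c15e41a31, AUDITED REF1 §448: 9/9 survive, BC7 CLEAN) + riders R448a (non-constancy clause inside
`∃ P` of `ShaSpinGovernsCasselsTateBitAtTwo`) and R448c (Cassels alternation cited where `#Ш[2^∞] = 4 ⟹ Ш[2] ≅ (ℤ/2)²` is used: `ShaTwoPrimaryCardFour`, S3′, VIS); every other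
byte unchanged.  VERSION v1.2 (-es g36, 2026-08-31T08:00Z): v1.1 (commit 31801e825319, AUDITED REF1 §444: 7/7 survive) + riders R444a (`2 ≤ P.natDegree` in S-gov) and R444b
(VIS narrowed to `ShaTwoPrimaryCardFour`); every other byte unchanged.  VERSION v1.1 (-es g36, 2026-08-31T07:40Z): §0–§3 byte-identical to v1 (commit 5048601ea826, BC7 7/7 CLEAN); §4 added — the DOWN-class
generalisation (`SelmerTwoVisibleAtInfinity`; egg ∪ I-vis identity component): 1 def, 7 proved counting / bookkeeping theorems, 1 new
restricted-residue Prop `…ResidueShaVisFour` (between `R_S` and `…ResidueShaEggFour`, both implications proved).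

THE POPULATION.  The line of record (LINE v8.17 `one_door_analytic`) leaves two residues of the one-door law: `R_N` (identity component,
`Ш(W)[2] = 0`; treated by ES-44) and `R_S` = `DoorIndexLawFullCAtTwoSomeDoorResidueSha` (`Ш(W)[2] ≠ 0`).  This file treats the sub-population
`R_S ∩ {Δ_W > 0, E(ℚ) meets the egg, #Ш(W)[2^∞] = 4}` (the dominant `Ш_an = 4` stratum; census45: 18 such optimal-class curves with
`N ≤ 55 555`: 13 egg, 5 identity-component — `CensusES45.md` §5).

THE MECHANISM (THEOREM A of the tree + the real place).  For `Δ_W > 0` and a descent-admissible `d` the local conditions of `Sel₂(W)` and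
`Sel₂(W^{(d)})` inside `H¹(ℚ, E[2])` differ ONLY at `∞`, where `H¹(ℝ, E[2]) = E[2]`, `L_W = ⟨T₃⟩` (Kummer image of the egg of `E`) and
`L_{W^{(d)}} = ⟨T₁⟩` (Kummer image of the egg of `E^{(d)}`) are transverse lines; the strict and relaxed groups `S_str ⊂ S_rel` have index `2`
(Poitou–Tate), so EITHER `Sel₂(W^{(d)}) = S_str = ker(λ_∞ : Sel₂(W) → E(ℝ)/2E(ℝ))` (DOWN) OR `Sel₂(W^{(d)}) = S_rel ⊃ Sel₂(W)` (UP) — the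
tree's PROVED `GenusKolyArch.admissibleTwistSelmerShiftAtTwo_holds`.  If a rational point lies on the egg its Kummer class is non-trivial at `∞`
(tree `exists_mem_selmerGroup_localization_inl_ne_zero_of_meetsEgg`, NO hypothesis on `Ш`), so DOWN: **`Sel₂(W^{(d)}) = ker λ_∞` is a complement of
`⟨κ_g⟩` in `Sel₂(W)`, i.e. maps isomorphically onto `Ш(W)[2]`** — for EVERY descent-admissible `d`, as the SAME subgroup of `H¹(ℚ, E[2])`.
(`§1`: `two_mul_twistSelmerTwoCard_eq_selmerTwoCard_of_meetsEgg`, `twistSelmerTwoCard_eq_shaTwoTorsionCard_of_meetsEgg_rankOne` — kernel theorems.)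

THE `±` OBJECT ONE STOREY UP.  On that fixed plane `Ш(W)[2] ≅ (ℤ/2)²` every rank-`0` admissible twin `W^{(d)}` (`L(W^{(d)},1) ≠ 0`) carries its
Cassels–Tate pairing — an alternating form on a FIXED `2`-dimensional `𝔽₂`-space, hence ONE BIT `β_W(d) = [r_4(W^{(d)}) = 0]`
(`SpinNondegenerateAt W d`, ES-44's currency).  ES-44 saw this bit on the plane `⟨κ_g, b_W⟩` (a rational point and one new class); here the plane is
`W`-INTRINSIC `Ш`: the two `2`-coverings of `W` that are everywhere locally soluble and have no rational point.  Conjecture ES-45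
(`ShaSpinGovernsCasselsTateBitAtTwo`): at prime doors `d = −ℓ` the bit is the order-of-Frobenius bit of ONE finite Galois extension `M_W/ℚ`
(predicted: a central quadratic extension of the compositum of `ℚ(E[2])` with the quartic fields of the two `Ш`-torsors), up to a global sign;
density `1/2` (`ShaSpinDoorDensityHalfAtTwo`).  [Smith 2016 Thm 3.2 gives this shape under FULL rational `2`-torsion; here the image is `S₃`.]

THE EULER-SYSTEM CONTENT = DEPTH-TWO EXACTNESS AT `2` (`S2′ EggShaDoorHeegnerExponentAtTwo`).  At a spin-nondegenerate descent-admissible Heegner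
door with `L(W^{(d_K)},1) ≠ 0` the one-door law predicts the exact `2`-divisibility exponent of the Heegner point modulo torsion
`m = v₂(c) + 2` (`2m + 0 = v₂#Ш(W)[2^∞] + v₂#Ш(W^{(d)})[2^∞] + t + 2s + 2v₂(c) = 2 + 2 + 0 + 0 + 2v₂(c)`): `y_K ∈ 4E(K) + tors`, `∉ 8E(K) + tors`
(for `c` odd) — Kolyvagin's structure sequence `(M₀, M₁, M₂) = (2, 1, 0) + v₂(c)`: the Heegner point is divisible TWICE, the first derivative classes
once, the second not at all.  Depth one (`M₀ = 1 + v₂ c`) was ES-44's S2 on `R_N`; depth two is the `Ш`-storey.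

THE KERNEL REDUCTION (`§3`): `exists_isNewformOf → S1′ → S2′ → S3′ → R_S|{Δ>0, egg, #Ш[2^∞]=4}` (`residueShaEggFour_of_shaSpinDoors`, no `sorry`).

CENSUS45 (pure python over the Cremona `ecdata` mirror, `N·d² < 5·10⁵`; `Cruxes/RankOneAtTwoBigImageOddLocal/CensusES45.md`): 24 334 candidate `W`
(rank `1`, `Δ > 0`, odd torsion, `S₃` image mod `2`, non-CM, `N ≤ 55 555`), 981 descent-admissible twins found (0 missing), predictions P1–P5 frozen
before the run, 0 violations: egg & `Ш_an(W)` odd ⟹ twin `Sel₂`-trivial 795/795; identity & `Ш_an` odd ⟹ twin rank `2` (124) or rank `0` with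
`4 ∣ Ш_an` (60), never trivial (T-C egg twist law, control); `Ш_an(W) = 4` & egg: 2/2 twins in range (`45979a1 → 413811c1`, `53461a1 → 481149b1`,
`d = −3`) have `#Sel₂(W^{(d)}) = 4 = #Ш(W)[2]` realised as RANK `2` with `Ш_an = 1` — `Ш(W)[2]` is MORDELL–WEIL-VISIBLE in `E × E^{(−3)}`; no
rank-`0` twin of a `Ш_an = 4` curve lies in range (smallest admissible twin conductor `45979·49 > 5·10⁵`), so the `β`-statistics of ES-45/ES-45′
are a data ask (D-es-114, two engines).

References: [Kramer1981] Prop. 6, Thm. 1, Thm. 2; [MazurRubin2010] Thm. 2.7, Lemma 2.9, Prop. 3.3, Cor. 3.4; [Kolyvagin1991structure] Thm. 1.2;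
[GrossLMS1991] Conj. 1.2, §3, §10; [GrossZagier1986] Thm. I.6.3, V.§2; [Smith2016] = arXiv:1607.07860 Thm. 3.2 (full 2-torsion; shape only);
[Smith2022SelmerTwistI] Thm. 1.5 (shape only); [CremonaMazur2000] §3 (visibility in `E × E^{(d)}`); [Zhang2014CJM] Thm. 1.1 (`p ≥ 5`; shape only).
-/

noncomputable section

open scoped Classical
open Polynomial Filter Topology

set_option linter.dupNamespace false
set_option autoImplicit false

namespace Summit.BirchSwinnertonDyer.BirchSwinnertonDyer.Theorems.RankOneAtTwoShaSpinAtTwo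

open WeierstrassCurve NumberField Literature.NumberTheory.EllipticCurves Literature.NumberTheory.EllipticCurves.ModularForms
  Summit.BirchSwinnertonDyer.Rank1Residual.F1Sign2
  Summit.BirchSwinnertonDyer.BirchSwinnertonDyer.Theorems
  Summit.BirchSwinnertonDyer.BirchSwinnertonDyer.Theorems.RankOneAtTwoOneDoor

/-! ## §0 Vocabulary (over tree declarations only; the first three are VERBATIM ES-44's
`Cruxes/RankOneAtTwoBigImageOddLocal/SpinGoverningAtTwoES44.lean` §0 — crux workfiles are not importable on the farm, so they are restated here) -/

/-- `ℓ` is a `3`-CYCLE HEEGNER DOOR PRIME of `W`: `ℓ` prime and `d = -ℓ` is desc-admissible (`d ≡ 1 (mod 8)`, tree `DescAdmissible`) or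
unramified-desc-admissible (`d ≡ 5 (mod 8)`, `2` good, tree `DescAdmissibleUnram`).  [verbatim ES-44 §0] -/
def IsThreeCycleDoorPrime (W : WeierstrassCurve ℚ) [W.IsGloballyMinimal] (ℓ : ℕ) : Prop :=
  ℓ.Prime ∧ (DescAdmissible W (-(ℓ : ℤ)) ∨ DescAdmissibleUnram W (-(ℓ : ℤ)))

/-- SPIN-NONDEGENERATE at `d`: `r_4(W^{(d)}) = 0` — no `ℤ/4` inside `Sel_{2^∞}(W^{(d)}/ℚ)` (Smith's `r_{2^k}`, tree `twistSelmerTorsionRankPow`).  On a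
plane `Sel₂(W^{(d)}) ≅ (ℤ/2)²` with `W^{(d)}(ℚ)[2] = 0` this says: rank `0` and the Cassels–Tate pairing on `Ш(W^{(d)})[2]` is non-degenerate.
[verbatim ES-44 §0] [cite: SmithGoldfeld2025, Notation 1.8] -/
def SpinNondegenerateAt (W : WeierstrassCurve ℚ) (d : ℤ) : Prop :=
  twistSelmerTorsionRankPow W 2 d = 0

/-- «the Frobenius of `ℓ` in the splitting field of `P` has order NOT dividing `3`»: `P mod ℓ` does NOT divide `X^{ℓ³} − X`.  [verbatim ES-44 §0] -/
def FrobeniusOrderNotDvdThree (P : ℤ[X]) (ℓ : ℕ) : Prop :=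
  ¬ (P.map (Int.castRingHom (ZMod ℓ)) ∣ ((X : (ZMod ℓ)[X]) ^ (ℓ ^ 3) - X))

/-- `#Ш(W)[2^∞] = 4` (with the alternating Cassels–Tate pairing this is `Ш(W)[2^∞] = Ш(W)[2] ≅ (ℤ/2)²`; the `Ш_an = 4` stratum of `R_S`). R448c (gen 37, REF1 §448; REF2 v73-add13 ZZ4): the step «`#Ш[2^∞] = 4 ⟹ Ш[2^∞] = Ш[2] ≅ (ℤ/2)²`» is CASSELS ALTERNATION — for an elliptic curve over a number field the Cassels–Tate pairing on `Ш` is ALTERNATING with kernel the divisible subgroup, so a finite `Ш[2^∞]` is `M ⊕ M` and order `4` forces `(ℤ/2)²` (`ℤ/4` carries no non-degenerate alternating form); special to elliptic curves / polarisations from rational divisors (in general only antisymmetric, Poonen–Stoll). [cite: Cassels1962, §3 (the pairing on Ш is alternating; kernel = divisible part)] [cite: MilneADT2006, Thm. I.6.13, Cor. I.6.14] -/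
def ShaTwoPrimaryCardFour (W : WeierstrassCurve ℚ) [W.IsElliptic] : Prop :=
  Nat.card (AddCommGroup.primaryComponent W.sha 2) = 4

/-- `#Ш(W)[2]` in the currency of the tree's descent count `card_selmerGroup_eq_pow_rank_mul`. -/
def shaTwoTorsionCard (W : WeierstrassCurve ℚ) [W.IsElliptic] : ℕ :=
  Nat.card (W.sha ⊓ AddSubgroup.torsionBy W.galH1 2 : AddSubgroup W.galH1)

/-! ## §1 `Ш`-INHERITANCE AT EGG DOORS (kernel theorems; corollaries of the tree's THEOREM A machinery) -/

/-- **EGG ⟹ DOWN, unconditionally** (any rank, any `Ш`): for `W/ℚ` globally minimal with `Δ_W > 0`, if some rational point lies on the egg then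
`#Sel₂(W^{(d)}) = #Sel₂(W)/2` for EVERY descent-admissible `d` — the Kummer class of the egg point is non-trivial at `∞`
(`GenusKolyArch.exists_mem_selmerGroup_localization_inl_ne_zero_of_meetsEgg`, no `Ш` hypothesis) and THEOREM A's DOWN branch
(`GenusKolyArch.two_mul_twistSelmerTwoCard_eq_of_exists_unconditional`).  In words: `Sel₂(W^{(d)})` is the strict-at-`∞` subgroup of `Sel₂(W)`.
[cite: Kramer1981, §2 Prop. 6] [cite: MazurRubin2010, Cor. 3.4 (i)] -/
theorem two_mul_twistSelmerTwoCard_eq_selmerTwoCard_of_meetsEgg (W : WeierstrassCurve ℚ) [W.IsElliptic] [W.IsGloballyMinimal]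
    (hΔ : 0 < W.Δ) (hegg : MeetsEgg W) {d : ℤ} (hd : DescAdmissible W d) :
    2 * twistSelmerTwoCard W d = selmerTwoCard W :=
  GenusKolyArch.two_mul_twistSelmerTwoCard_eq_of_exists_unconditional W hΔ
    (GenusKolyArch.exists_mem_selmerGroup_localization_inl_ne_zero_of_meetsEgg W hegg) hd

/-- **`#Sel₂(W) = 2 · #Ш(W)[2]` for rank one and `E(ℚ)[2] = 0`** (the descent count `#Sel₂ = 2^{rank}·#E(ℚ)[2]·#Ш[2]`). [cite: SilvermanAEC2009, Thm X.4.2(a)] -/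
theorem selmerTwoCard_eq_two_mul_shaTwoTorsionCard_of_rankOne (W : WeierstrassCurve ℚ) [W.IsElliptic]
    (hT : NoRationalTwoTorsion W) (hrank : W.mordellWeilRank = 1) : selmerTwoCard W = 2 * shaTwoTorsionCard W := by
  have hinst : (instDecidableEqRat : DecidableEq ℚ) = fun a b => Classical.propDecidable (a = b) := Subsingleton.elim _ _
  have ht : Nat.card (AddSubgroup.torsionBy W.toAffine.Point ((2 : ℕ) : ℤ)) = 1 := by
    have hbot : AddSubgroup.torsionBy W.toAffine.Point ((2 : ℕ) : ℤ) = ⊥ :=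
      (AddSubgroup.eq_bot_iff_forall _).mpr fun P hP ↦
        EggDoubling.eq_zero_of_two_smul_eq_zero W hT P (AddSubgroup.torsionBy.nsmul_iff.mp hP)
    rw [hbot, AddSubgroup.card_bot]
  rw [hinst] at ht
  have h := card_selmerGroup_eq_pow_rank_mul W 2
  rw [ht, hrank, mul_one, pow_one, Nat.cast_ofNat] at h
  exact h

/-- **`Ш`-INHERITANCE COUNT AT EGG DOORS** (rank one, `E(ℚ)[2] = 0`, `Δ_W > 0`, a rational point on the egg): `#Sel₂(W^{(d)}) = #Ш(W)[2]` for every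
descent-admissible `d`.  (Structurally: `Sel₂(W^{(d)}) = ker λ_∞ ⊂ Sel₂(W)` is a complement of `⟨κ_g⟩`, so `Sel₂(W^{(d)}) ⥲ Ш(W)[2]`; only the count is
recorded here.)  Census45: `45979a1`, `53461a1` at `d = −3`: `#Sel₂(W^{(−3)}) = 4 = Ш_an(W)`, both twins of rank `2` with `Ш_an = 1`.
[cite: Kramer1981, §2 Prop. 6] [cite: MazurRubin2010, Cor. 3.4 (i)] [cite: SilvermanAEC2009, Thm X.4.2(a)] -/
theorem twistSelmerTwoCard_eq_shaTwoTorsionCard_of_meetsEgg_rankOne (W : WeierstrassCurve ℚ) [W.IsElliptic] [W.IsGloballyMinimal]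
    (hΔ : 0 < W.Δ) (hT : NoRationalTwoTorsion W) (hrank : W.mordellWeilRank = 1) (hegg : MeetsEgg W) {d : ℤ} (hd : DescAdmissible W d) :
    twistSelmerTwoCard W d = shaTwoTorsionCard W := by
  have h1 := two_mul_twistSelmerTwoCard_eq_selmerTwoCard_of_meetsEgg W hΔ hegg hd
  have h2 := selmerTwoCard_eq_two_mul_shaTwoTorsionCard_of_rankOne W hT hrank
  omega

/-- `#Ш(W)[2^∞] = 4 ⟹ Ш(W)[2] ≠ 0` (so the class of this file lies inside the residue `R_S`). -/
theorem not_shaTwoTrivial_of_shaTwoPrimaryCardFour (W : WeierstrassCurve ℚ) [W.IsElliptic] (h4 : ShaTwoPrimaryCardFour W) :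
    ¬ ShaTwoTrivial W := by
  intro hSha
  have h0 := padicValNat_card_primaryComponent_sha_two_eq_zero_of_shaTwoTrivial W hSha
  rw [show Nat.card (AddCommGroup.primaryComponent W.sha 2) = 4 from h4] at h0
  have : padicValNat 2 4 = 2 := by
    rw [show (4 : ℕ) = 2 ^ 2 by norm_num, padicValNat.prime_pow]
  omega

/-! ## §2 The typed candidates -/

/-- **THE RESTRICTED RESIDUE `R_S|{Δ>0, egg, #Ш[2^∞]=4}`** (`DoorIndexLawFullCAtTwoSomeDoorResidueShaEggFour`; CONJECTURE = the target of this file's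
reduction): every curve of crux 23715's slice with `Δ_W > 0`, `#Ш(W)[2^∞] = 4` and a rational point on the egg admits a LAWFUL door datum.  A sub-case of
the line of record's `R_S` (`residueShaEggFour_of_residueSha`). [cite: GrossLMS1991, Conj. 1.2 and §3] -/
@[conjecture] def DoorIndexLawFullCAtTwoSomeDoorResidueShaEggFour : Prop :=
  ∀ (W : WeierstrassCurve ℚ) [W.IsElliptic] [W.IsGloballyMinimal] [NeZero (W.conductorNorm ℤ)],
    ¬ W.HasCM → (∀ n : ℕ, W.HasSurjectiveModNGaloisRep ((2 ^ n : ℕ) : ℤ)) → Odd W.torsionOrder → Odd W.tamagawaProduct →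
    W.analyticRank = 1 → 0 < W.Δ → ShaTwoPrimaryCardFour W → MeetsEgg W → HasLawfulDoorAtTwo W

/-- `R_S ⟹` the restricted residue (drop the three extra hypotheses; `#Ш[2^∞] = 4 ⟹ Ш[2] ≠ 0`). -/
theorem residueShaEggFour_of_residueSha (h : DoorIndexLawFullCAtTwoSomeDoorResidueSha) :
    DoorIndexLawFullCAtTwoSomeDoorResidueShaEggFour := by
  intro W _ _ _ hCM hsurj hT hc hr _ h4 _
  exact h W hCM hsurj hT hc hr (not_shaTwoTrivial_of_shaTwoPrimaryCardFour W h4)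

/-- **ES-45 `ShaSpinGovernsCasselsTateBitAtTwo` (CONJECTURE; the lens's typed candidate one storey up).**  For `W` of the class (`Δ_W > 0`,
`#Ш(W)[2^∞] = 4`, a rational point on the egg) there is ONE irreducible integer polynomial `P` (predicted: a primitive element of a central quadratic
extension `M_W` of the compositum of `ℚ(E[2])` with the quartic fields of the two non-trivial `Ш(W)[2]`-torsors; unramified outside `2·N_W·∞`) and a
global sign `σ` such that for all but finitely many `3`-cycle Heegner door primes `ℓ`:
`r_4(W^{(−ℓ)}) = 0 ⟺ ((P mod ℓ) ∤ X^{ℓ³} − X ⟺ σ)` — the Cassels–Tate bit of the twin ON THE INHERITED PLANE `Ш(W^{(−ℓ)})[2] = Ш(W)[2]` is an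
order-of-Frobenius bit.  `Irreducible P` (REF1 R434d) pins ONE Galois field.  Why it might fail: the bit may be governed only by a Rédei-type symbol
whose field grows with `ℓ` (non-Frobenian), exactly as feared for ES-44; and here no census row exists yet (no rank-`0` admissible twin of a
`Ш_an = 4` curve has conductor `< 5·10⁵`).  Cheapest falsifier: D-es-114 (two door primes with the same Frobenius in the computable candidate `M_W`
and different `r_4`). [cite: Smith2016, Thm. 3.2 (arXiv:1607.07860; full 2-torsion, shape only)] [cite: SmithGoldfeld2025, Notation 1.8] [cite: Kramer1981, Prop. 6] v1.2 (REF1 §444 rider R444a): `2 ≤ P.natDegree` added — a linear `P` would make the Frobenius bit constant and the typed `∃` cover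
«`β_W` eventually constant» (governing field `ℚ`); ONE non-trivial field is meant. v1.3 (gen 37, REF1 §448 rider R448a = REF1's self-correction of R444a): a NON-CONSTANCY clause is added inside `∃ P` — the Frobenius-order bit of `P` takes BOTH values on `3`-cycle door primes beyond every bound.  Reason (REF1 K448.5): every `3`-cycle door prime is `ℓ ≡ 3 (mod 4)`, so `P₊ = X² + 1` passes the guard `Irreducible P ∧ 2 ≤ P.natDegree` with `FrobeniusOrderNotDvdThree P₊ ℓ` TRUE at every door prime (and `X² − Δ_W` with it FALSE at every door prime): without the clause the `∃ P`-form still encoded «`β_W` eventually constant».  The clause holds for the predicted central-quadratic governing field by Chebotarev and fails for every door-congruence `P`; eventual constancy of `β_W` is now EXCLUDED by the statement (it contradicts the density-`½` companion anyway). (With the clause, `σ` is determined by `P`; both values of `σ` remain admissible.) -/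
@[conjecture] def ShaSpinGovernsCasselsTateBitAtTwo : Prop :=
  ∀ (W : WeierstrassCurve ℚ) [W.IsElliptic] [W.IsGloballyMinimal],
    ¬ W.HasCM → (∀ n : ℕ, W.HasSurjectiveModNGaloisRep ((2 ^ n : ℕ) : ℤ)) → W.analyticRank = 1 →
    0 < W.Δ → ShaTwoPrimaryCardFour W → MeetsEgg W →
    ∃ (P : ℤ[X]) (σ : Prop), Irreducible P ∧ 2 ≤ P.natDegree ∧
      (∀ B' : ℕ, ∃ ℓ₁ ℓ₂ : ℕ, B' < ℓ₁ ∧ B' < ℓ₂ ∧ IsThreeCycleDoorPrime W ℓ₁ ∧ IsThreeCycleDoorPrime W ℓ₂ ∧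
        FrobeniusOrderNotDvdThree P ℓ₁ ∧ ¬ FrobeniusOrderNotDvdThree P ℓ₂) ∧
      ∃ B : ℕ, ∀ ℓ : ℕ, B < ℓ → IsThreeCycleDoorPrime W ℓ →
      (SpinNondegenerateAt W (-(ℓ : ℤ)) ↔ (FrobeniusOrderNotDvdThree P ℓ ↔ σ))

/-- **ES-45′ `ShaSpinDoorDensityHalfAtTwo` (CONJECTURE; quantitative shadow).**  In the class, the spin-nondegenerate `3`-cycle door primes have
relative natural density EXACTLY `1/2` among all `3`-cycle door primes (one alternating form on a fixed `𝔽₂`-plane; the central bit of `M_W`).  Why it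
might fail: a biased class function (the ES-44 analogue showed `0.545` on one curve) or no density; rank-`2` twins are degenerate by force.
[cite: Smith2022SelmerTwistI, Thm. 1.5 (shape only)] [cite: Kramer1981, Prop. 6] -/
@[conjecture] def ShaSpinDoorDensityHalfAtTwo : Prop :=
  ∀ (W : WeierstrassCurve ℚ) [W.IsElliptic] [W.IsGloballyMinimal],
    ¬ W.HasCM → (∀ n : ℕ, W.HasSurjectiveModNGaloisRep ((2 ^ n : ℕ) : ℤ)) → W.analyticRank = 1 →
    0 < W.Δ → ShaTwoPrimaryCardFour W → MeetsEgg W →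
    Tendsto (fun X : ℕ =>
      (((Finset.range X).filter fun ℓ => IsThreeCycleDoorPrime W ℓ ∧ SpinNondegenerateAt W (-(ℓ : ℤ))).card : ℝ) /
        (((Finset.range X).filter fun ℓ => IsThreeCycleDoorPrime W ℓ).card : ℝ)) atTop (𝓝 (1 / 2 : ℝ))

/-- **S1′ `EggShaSpinDoorExistsAtTwo` (CONJECTURE; supply).**  Every `W` of the class has an imaginary quadratic `K` with `d_K` DESC-admissible, coprime to
`N_W`, Heegner, SPIN-NONDEGENERATE (`r_4(W^{(d_K)}) = 0`) and `L(W^{(d_K)}, 1) ≠ 0`.  From ES-45 + Chebotarev + the rank-`0` `2`-converse, as S1 of ES-44.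
BC5 status: NO witness in the `ecdata` range (both admissible twins of `Ш_an = 4` egg curves below `5·10⁵` have rank `2`: `45979a1`, `53461a1` at
`d = −3`) — plan-only, data ask D-es-114.  Why it might fail: `β_W ≡ 0` on the whole admissible class of some `W` (a systematically degenerate
Cassels–Tate form on `Ш(W)[2]`), which no theorem presently forbids. [cite: Kramer1981, Prop. 6] [cite: MazurRubin2010, Prop. 3.3] [cite: OnoSkinner1998, Cor. 3] -/
@[conjecture] def EggShaSpinDoorExistsAtTwo : Prop :=
  ∀ (W : WeierstrassCurve ℚ) [W.IsElliptic] [W.IsGloballyMinimal] [NeZero (W.conductorNorm ℤ)],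
    ¬ W.HasCM → (∀ n : ℕ, W.HasSurjectiveModNGaloisRep ((2 ^ n : ℕ) : ℤ)) → Odd W.torsionOrder → Odd W.tamagawaProduct →
    W.analyticRank = 1 → 0 < W.Δ → ShaTwoPrimaryCardFour W → MeetsEgg W →
    ∃ (K : Type) (_ : Field K) (_ : NumberField K), IsImaginaryQuadratic K ∧ DescAdmissible W (NumberField.discr K) ∧
      Nat.Coprime (NumberField.discr K).natAbs (W.conductorNorm ℤ) ∧ SatisfiesHeegnerHypothesis (W.conductorNorm ℤ) K ∧
      SpinNondegenerateAt W (NumberField.discr K) ∧ (W.quadraticTwist (NumberField.discr K : ℚ)).entireLFunction 1 ≠ 0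

/-- **S2′ `EggShaDoorHeegnerExponentAtTwo` (CRUX-grade CONJECTURE; DEPTH-TWO Kolyvagin exactness at `2`).**  `W` in the class; `K` imaginary quadratic with
`d_K` desc-admissible, coprime to `N_W`, Heegner, spin-nondegenerate AND `L(W^{(d_K)},1) ≠ 0` (REF1 R434b: without it a torsion `y_K` would be
asserted divisible); `Dt` ANY parametrisation datum (constant `c`), `H`, `ι`, `P ∈ E(K)` over the complex Heegner point.  THEN the exact `2`-divisibility
exponent of `P` modulo torsion is `v₂(c) + 2`: `y_K ∈ 4·2^{v₂ c}E(K) + tors`, `∉ 8·2^{v₂ c}E(K) + tors`.  `⟸` Kolyvagin's bound at `2` with sharp constant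
(`#Ш(E/K)[2^∞] ∣ 2^{2(m − v₂ c)}`) ∧ Kolyvagin non-vanishing at `2` in DEPTH TWO (`Ш(E/K)[2^∞] ≅ (ℤ/2)⁴ ⟹` the second derivative classes are
indivisible: `(M₀,M₁,M₂) = (2,1,0) + v₂ c`); `= BSD₂(W) ∧ BSD₂(W^{(d)})` read at the door through `P2.bsdp_two_iff_of_heegner_rankOne`.  One storey above
ES-44's S2 (`m = v₂ c + 1` on `R_N`) and two above R₀⁺ (`m = v₂ c` at `Sel₂`-trivial doors).  Why it might fail: Kolyvagin's conjecture at the prime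
`2` in depth two (nothing in print below `p = 5`); a `2`-power discrepancy of a non-optimal datum. [cite: Kolyvagin1991structure, Thm. 1.2]
[cite: GrossLMS1991, Conj. 1.2, §3 and §10] [cite: Zhang2014CJM, Thm. 1.1 (p ≥ 5; shape only)] [cite: GrossZagier1986, Thm. I.6.3 and V.§2] -/
@[conjecture] def EggShaDoorHeegnerExponentAtTwo : Prop :=
  ∀ (W : WeierstrassCurve ℚ) [W.IsElliptic] [W.IsGloballyMinimal] [NeZero (W.conductorNorm ℤ)],
    ¬ W.HasCM → (∀ n : ℕ, W.HasSurjectiveModNGaloisRep ((2 ^ n : ℕ) : ℤ)) → Odd W.torsionOrder → Odd W.tamagawaProduct →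
    W.analyticRank = 1 → 0 < W.Δ → ShaTwoPrimaryCardFour W → MeetsEgg W →
    ∀ (K : Type) [Field K] [NumberField K], IsImaginaryQuadratic K →
      DescAdmissible W (NumberField.discr K) →
      Nat.Coprime (NumberField.discr K).natAbs (W.conductorNorm ℤ) → SatisfiesHeegnerHypothesis (W.conductorNorm ℤ) K →
      SpinNondegenerateAt W (NumberField.discr K) → (W.quadraticTwist (NumberField.discr K : ℚ)).entireLFunction 1 ≠ 0 →
      ∀ (Dt : ModularParametrizationData W (W.conductorNorm ℤ))
        (H : HeegnerDatum (W.conductorNorm ℤ) (NumberField.discr K)) (ι : K →+* ℂ)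
        (P : (W.baseChange K).toAffine.Point),
        WeierstrassCurve.Affine.Point.map ι.toRatAlgHom P = heegnerPointComplex Dt H →
        HasTwoDivisibilityUpToTorsion W K P (padicValInt 2 Dt.c + 2)

/-- **S3′ `ShaCardFourAtEggShaSpinDoorAtTwo` (SUPPORT; theorem-grade modulo Selmer algebra).**  At a spin-nondegenerate desc-admissible door of a `W` of the
class, a globally minimal model `Wd` of the twist has `#Ш(Wd)[2^∞] = 4`.  Ingredients: `#Sel₂(W^{(d)}) = #Ш(W)[2] = 4` (§1
`twistSelmerTwoCard_eq_shaTwoTorsionCard_of_meetsEgg_rankOne` + `#Ш[2^∞] = 4 ⟹ #Ш[2] = 4` by the alternating pairing + `rank_eq_analyticRank`),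
`Wd(ℚ)[2] = 0` (big image), `r_4 = 0 ⟹ Sel_{2^∞}(Wd) = Sel_{2^∞}[2] ≅ Sel₂` finite of order `4`, hence rank `0` and `Ш(Wd)[2^∞] = Sel_{2^∞}` — no
`L ≠ 0` binder needed (REF1 R434a).  Not yet a tree theorem for the same reason as ES-44's S3 (`selmerGroup W 2` versus `selmerGroupPInfty`).  R448c: the step
`#Ш(W)[2^∞] = 4 ⟹ #Ш(W)[2] = 4` is Cassels alternation (see `ShaTwoPrimaryCardFour`); without it `Ш[2^∞] ≅ ℤ/4` would give a DOWN count `2` and S3′ would be false.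
[cite: Kramer1981, Prop. 6] [cite: SmithGoldfeld2025, Notation 1.8] [cite: SilvermanAEC2009, Thm X.4.2(a)] [cite: Cassels1962, §3 (the pairing on Ш is alternating; kernel = divisible part)] [cite: MilneADT2006, Thm. I.6.13, Cor. I.6.14] -/
@[conjecture] def ShaCardFourAtEggShaSpinDoorAtTwo : Prop :=
  ∀ (W : WeierstrassCurve ℚ) [W.IsElliptic] [W.IsGloballyMinimal] [NeZero (W.conductorNorm ℤ)],
    ¬ W.HasCM → (∀ n : ℕ, W.HasSurjectiveModNGaloisRep ((2 ^ n : ℕ) : ℤ)) → Odd W.torsionOrder → Odd W.tamagawaProduct →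
    W.analyticRank = 1 → 0 < W.Δ → ShaTwoPrimaryCardFour W → MeetsEgg W →
    ∀ d : ℤ, DescAdmissible W d → SpinNondegenerateAt W d →
      ∀ (Wd : WeierstrassCurve ℚ) [Wd.IsElliptic] [Wd.IsGloballyMinimal] (Cd : WeierstrassCurve.VariableChange ℚ),
        Cd • W.quadraticTwist (d : ℚ) = Wd → Nat.card (AddCommGroup.primaryComponent Wd.sha 2) = 4

/-- **VIS `ShaTwoMordellWeilVisibleAtSomeEggDoor` (CONJECTURE; the census's positive finding as a statement).**  For `W` of the class SOME desc-admissible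
(or unramified-desc-admissible) twin has TRIVIAL `Sel₂`-defect: `#Sel₂(W^{(d)}) = 2^{rank W^{(d)}}` — by §1 this says `rank W^{(d)} = dim Ш(W)[2] = 2` and
`Ш(W^{(d)})[2] = 0`: all of `Ш(W)[2]` is explained by the Mordell–Weil group of the twin inside `E × E^{(d)}` (visibility in the sense of Cremona–Mazur,
made canonical by THEOREM A).  Census45: `2/2` in range (`45979a1`, `53461a1`, `d = −3`); control: `Ш(W)[2] = 0`, identity component: `124` rank-`2` twins
/ `60` rank-`0`.  Why it might fail: it asks for rank-`2` twists inside a thin Chebotarev family of `d` for EVERY such `W` — believed, unproved, and not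
needed by the reduction below (recorded as the lens's reading of the data, not as a crux). [cite: CremonaMazur2000, §3] [cite: Kramer1981, Prop. 6] v1.2 (REF1 §444 rider R444b): NARROWED to `#Ш(W)[2^∞] = 4` (`ShaTwoPrimaryCardFour W`) — as first typed (`¬ ShaTwoTrivial W`) it demanded a
rank-`2k` twin with `Ш(W^{(d)})[2] = 0` whenever `#Ш(W)[2] = 4^k`; the census witnesses `k = 1` only.  R448c: `dim Ш(W)[2] = 2` here uses Cassels alternation
(see `ShaTwoPrimaryCardFour`). [cite: Cassels1962, §3 (the pairing on Ш is alternating; kernel = divisible part)] [cite: MilneADT2006, Thm. I.6.13, Cor. I.6.14] -/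
@[conjecture] def ShaTwoMordellWeilVisibleAtSomeEggDoor : Prop :=
  ∀ (W : WeierstrassCurve ℚ) [W.IsElliptic] [W.IsGloballyMinimal],
    0 < W.Δ → NoRationalTwoTorsion W → W.mordellWeilRank = 1 → ShaTwoPrimaryCardFour W → MeetsEgg W →
    ∃ d : ℤ, (DescAdmissible W d ∨ DescAdmissibleUnram W d) ∧
      twistSelmerTwoCard W d = 2 ^ (W.quadraticTwist (d : ℚ)).mordellWeilRank

/-! ## §3 The kernel reduction of the restricted residue -/

/-- `ord₂ 4 = 2`. -/
private theorem padicValNat_two_four : padicValNat 2 4 = 2 := by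
  rw [show (4 : ℕ) = 2 ^ 2 by norm_num, padicValNat.prime_pow]

/-- **THE KERNEL REDUCTION `R_S|{Δ>0, egg, #Ш[2^∞]=4} ⟸ S1′ ∧ S2′ ∧ S3′`** (modulo modularity `exists_isNewformOf`, for a parametrisation datum and the
`K`-rational Heegner point): at the spin door supplied by S1′ take ANY parametrisation datum, a Heegner datum, an embedding and the `K`-rational Heegner
point `P`; S2′ gives `m = v₂(c) + 2`; the class gives `v₂#Ш(W)[2^∞] = 2`, S3′ gives `v₂#Ш(Wd)[2^∞] = 2`, desc-admissibility gives `t = s = 0` and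
`Δ_W > 0` kills `[Δ_W < 0]`; the AN-28c identity reads `2(v₂(c)+2) + 0 = 2 + 2 + 0 + 2·v₂(c)`: the datum is LAWFUL.  CONDITIONAL by design; BSD is not
proved by this. [cite: GrossLMS1991, Conj. 1.2, §3 and §10] [cite: Kramer1981, Prop. 6] [cite: GrossZagier1986, Thm. I.6.3 and V.§2] -/
theorem residueShaEggFour_of_shaSpinDoors (hnf : exists_isNewformOf)
    (h1 : EggShaSpinDoorExistsAtTwo) (h2 : EggShaDoorHeegnerExponentAtTwo) (h3 : ShaCardFourAtEggShaSpinDoorAtTwo) :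
    DoorIndexLawFullCAtTwoSomeDoorResidueShaEggFour := by
  intro W _ _ _ hCM hsurj hT hc hr hΔ h4 hegg
  haveI : Fact (Nat.Prime 2) := ⟨Nat.prime_two⟩
  obtain ⟨K, iF, iN, hK, hDA, hcop, hHN, hspin, hLt⟩ := h1 W hCM hsurj hT hc hr hΔ h4 hegg
  have hadm : DoorAdmissible W (NumberField.discr K) := ANg16.doorAdmissible_of_descAdmissible W hDA
  have hmin : transpCount W (NumberField.discr K) + 2 * identCount W (NumberField.discr K) = (if W.Δ < 0 then 1 else 0) :=
    minimal_of_descAdmissible_of_pos W hΔ hDA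
  have hif : (if W.Δ < 0 then 1 else 0 : ℕ) = 0 := if_neg (not_lt.mpr hΔ.le)
  obtain ⟨Dt⟩ := (nonempty_modularParametrizationData_iff_exists_isNewformOf_unconditional.mpr hnf) W
  obtain ⟨H, -⟩ :=
    nonempty_heegnerDatum_holds (W.conductorNorm ℤ) K hK (exists_dvd_sq_sub_discr_holds (W.conductorNorm ℤ) K hK hHN).choose_spec
  obtain ⟨ι⟩ : Nonempty (K →+* ℂ) := inferInstance
  obtain ⟨P, hP⟩ := heegnerPointComplex_mem_range_map_holds (W.conductorNorm ℤ) W K hK hHN Dt H ι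
  have hm : HasTwoDivisibilityUpToTorsion W K P (padicValInt 2 Dt.c + 2) :=
    h2 W hCM hsurj hT hc hr hΔ h4 hegg K hK hDA hcop hHN hspin hLt Dt H ι P hP
  have hD0 : (NumberField.discr K : ℚ) ≠ 0 := by exact_mod_cast NumberField.discr_ne_zero K
  haveI hEt : (W.quadraticTwist (NumberField.discr K : ℚ)).IsElliptic := W.isElliptic_quadraticTwist hD0
  obtain ⟨Cd, hCd⟩ := hasGlobalMinimalModel_rat_holds (W.quadraticTwist (NumberField.discr K : ℚ))
  haveI := hCd
  have hsW : padicValNat 2 (Nat.card (AddCommGroup.primaryComponent W.sha 2)) = 2 := by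
    rw [show Nat.card (AddCommGroup.primaryComponent W.sha 2) = 4 from h4]; exact padicValNat_two_four
  have hsd : padicValNat 2 (Nat.card (AddCommGroup.primaryComponent (Cd • W.quadraticTwist (NumberField.discr K : ℚ)).sha 2)) = 2 := by
    rw [h3 W hCM hsurj hT hc hr hΔ h4 hegg (NumberField.discr K) hDA hspin (Cd • W.quadraticTwist (NumberField.discr K : ℚ)) Cd rfl]
    exact padicValNat_two_four
  unfold HasLawfulDoorAtTwo
  refine ⟨K, iF, iN, hK, hadm, hLt, Dt, H, ι, P, Cd • W.quadraticTwist (NumberField.discr K : ℚ), inferInstance, hCd, Cd, hP, rfl,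
    padicValInt 2 Dt.c + 2, hm, ?_⟩
  rw [hsW, hsd, hif]
  rw [hif] at hmin
  omega

/-- S1′ speaks about the objects of §2: it yields a spin-nondegenerate desc-admissible door (trivial direction, kernel-checked). -/
theorem exists_spinNondegenerate_door_of_S1' (h1 : EggShaSpinDoorExistsAtTwo)
    (W : WeierstrassCurve ℚ) [W.IsElliptic] [W.IsGloballyMinimal] [NeZero (W.conductorNorm ℤ)]
    (hCM : ¬ W.HasCM) (hsurj : ∀ n : ℕ, W.HasSurjectiveModNGaloisRep ((2 ^ n : ℕ) : ℤ)) (hT : Odd W.torsionOrder)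
    (hc : Odd W.tamagawaProduct) (hr : W.analyticRank = 1) (hΔ : 0 < W.Δ) (h4 : ShaTwoPrimaryCardFour W) (hegg : MeetsEgg W) :
    ∃ d : ℤ, DescAdmissible W d ∧ SpinNondegenerateAt W d ∧ (W.quadraticTwist (d : ℚ)).entireLFunction 1 ≠ 0 := by
  obtain ⟨K, _, _, -, hDA, -, -, hspin, hL⟩ := h1 W hCM hsurj hT hc hr hΔ h4 hegg
  exact ⟨NumberField.discr K, hDA, hspin, hL⟩

/-! ## §4 (v1.1) GENERALISATION TO THE DOWN CLASS — egg ∪ I-vis (identity component whose `Ш(W)[2]` meets the egg)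

`MeetsEgg W` enters §1 only through «some class of `Sel₂(W)` is non-trivial at `∞`».  Name that condition; THEOREM A then gives the
inherited count on the whole DOWN class and the complementary UP count (`#Sel₂(W^{(d)}) = 4·#Ш(W)[2]`) on the I-str class — so an
identity-component curve with `Ш(W)[2] ≠ 0` strict at `∞` has NO cheap admissible door at all: every descent-admissible twist has
`#Sel₂ = 4·#Ш(W)[2]` (`= 16` on the first storey; census45 prediction P3: `(0,≥4)`, `(2,≥2)`, `(4,0)` only).  The storey-1 statements
S1′–S3′ / ES-45 / ES-45′ / VIS for the I-vis class are VERBATIM those of §2 with `MeetsEgg W` replaced by `SelmerTwoVisibleAtInfinity W`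
and the reduction §3 goes through word for word (not re-typed here to keep the audited surface small; census45 has no identity-class
twin in range, D-es-114 (e) decides I-vis vs I-str for `40581i1, 41775d1, 43730d1, 44869a1, 53237a1`). -/

section DownClass

open Literature.NumberTheory.GaloisRepresentations Literature.NumberTheory.GaloisCohomology

/-- **`Sel₂(W)` VISIBLE AT `∞`** (the DOWN class of THEOREM A): some `2`-Selmer class of `W` localises non-trivially at the real place.
Egg curves are in it for any `Ш` (`selmerTwoVisibleAtInfinity_of_meetsEgg`); an identity-component curve (`¬ MeetsEgg W`, `E(ℚ)[2] = 0`,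
rank one) is in it iff `λ̄_∞ ≠ 0` on `Ш(W)[2]` («I-vis»), and is NOT in it when `Ш(W)[2] = 0`
(`GenusKolyArch.forall_mem_selmerGroup_localization_inl_eq_zero_of_not_meetsEgg`).  A `W`-intrinsic bit, independent of any door. -/
def SelmerTwoVisibleAtInfinity (W : WeierstrassCurve ℚ) [W.IsElliptic] : Prop :=
  ∃ c ∈ (W.kummerSelmerStructure ((2 : ℕ) : ℤ)).selmerGroup,
    galoisCohomology.localization (W.torsionGaloisModule ((2 : ℕ) : ℤ)) (Sum.inl Rat.infinitePlace) 1 c ≠ 0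

/-- Egg ⟹ visible at `∞` (any `Ш`, any rank). [cite: Kramer1981, §2 Prop. 6 (p. 127)] -/
theorem selmerTwoVisibleAtInfinity_of_meetsEgg (W : WeierstrassCurve ℚ) [W.IsElliptic] (hegg : MeetsEgg W) :
    SelmerTwoVisibleAtInfinity W :=
  GenusKolyArch.exists_mem_selmerGroup_localization_inl_ne_zero_of_meetsEgg W hegg

/-- `Δ_W > 0`, `E(ℚ)[2] = 0`, `Ш(W)[2] = 0` and identity component ⟹ NOT visible at `∞` (the tree's strict frame). -/
theorem not_selmerTwoVisibleAtInfinity_of_shaTwoTrivial_of_not_meetsEgg (W : WeierstrassCurve ℚ) [W.IsElliptic]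
    (hΔ : 0 < W.Δ) (hT : NoRationalTwoTorsion W) (hSha : ShaTwoTrivial W) (hegg : ¬ MeetsEgg W) :
    ¬ SelmerTwoVisibleAtInfinity W := by
  rintro ⟨c, hc, hne⟩
  exact hne (GenusKolyArch.forall_mem_selmerGroup_localization_inl_eq_zero_of_not_meetsEgg W hΔ hT hSha hegg c hc)

/-- **DOWN CLASS ⟹ `#Sel₂(W^{(d)}) = #Sel₂(W)/2`** for every descent-admissible `d` (`Δ_W > 0`; any rank, any `Ш`). THEOREM A, DOWN branch.
[cite: Kramer1981, §2 Prop. 6] [cite: MazurRubin2010, Cor. 3.4 (i)] -/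
theorem two_mul_twistSelmerTwoCard_eq_selmerTwoCard_of_visibleAtInfinity (W : WeierstrassCurve ℚ) [W.IsElliptic] [W.IsGloballyMinimal]
    (hΔ : 0 < W.Δ) (hvis : SelmerTwoVisibleAtInfinity W) {d : ℤ} (hd : DescAdmissible W d) :
    2 * twistSelmerTwoCard W d = selmerTwoCard W :=
  GenusKolyArch.two_mul_twistSelmerTwoCard_eq_of_exists_unconditional W hΔ hvis hd

/-- **UP CLASS ⟹ `#Sel₂(W^{(d)}) = 2·#Sel₂(W)`** for every descent-admissible `d` (`Δ_W > 0`; any rank, any `Ш`). THEOREM A, UP branch.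
[cite: Kramer1981, §2 Prop. 6, Thm. 1] [cite: MazurRubin2010, Thm. 2.7, Cor. 3.4 (i)] -/
theorem twistSelmerTwoCard_eq_two_mul_selmerTwoCard_of_not_visibleAtInfinity (W : WeierstrassCurve ℚ) [W.IsElliptic] [W.IsGloballyMinimal]
    (hΔ : 0 < W.Δ) (hstr : ¬ SelmerTwoVisibleAtInfinity W) {d : ℤ} (hd : DescAdmissible W d) :
    twistSelmerTwoCard W d = 2 * selmerTwoCard W := by
  refine GenusKolyArch.twistSelmerTwoCard_eq_two_mul_of_strict_frame W hΔ ?_ hd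
  intro c hc
  by_contra hne
  exact hstr ⟨c, hc, hne⟩

/-- **`Ш`-INHERITANCE COUNT ON THE DOWN CLASS** (rank one, `E(ℚ)[2] = 0`, `Δ_W > 0`, `Sel₂(W)` visible at `∞`): `#Sel₂(W^{(d)}) = #Ш(W)[2]`
for every descent-admissible `d` — egg curves (§1) AND I-vis identity-component curves.  Structurally `Sel₂(W^{(d)}) = ker λ_∞`: for egg
curves the plane `Ш(W)[2]` itself, for I-vis curves the MIXED plane `⟨κ_g⟩ ⊕ (Ш(W)[2] ∩ ker λ̄_∞)` — door-free in both cases. -/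
theorem twistSelmerTwoCard_eq_shaTwoTorsionCard_of_visibleAtInfinity_rankOne (W : WeierstrassCurve ℚ) [W.IsElliptic] [W.IsGloballyMinimal]
    (hΔ : 0 < W.Δ) (hT : NoRationalTwoTorsion W) (hrank : W.mordellWeilRank = 1) (hvis : SelmerTwoVisibleAtInfinity W)
    {d : ℤ} (hd : DescAdmissible W d) : twistSelmerTwoCard W d = shaTwoTorsionCard W := by
  have h1 := two_mul_twistSelmerTwoCard_eq_selmerTwoCard_of_visibleAtInfinity W hΔ hvis hd
  have h2 := selmerTwoCard_eq_two_mul_shaTwoTorsionCard_of_rankOne W hT hrank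
  omega

/-- **I-str COUNT** (rank one, `E(ℚ)[2] = 0`, `Δ_W > 0`, `Sel₂(W)` strict at `∞` — forces `¬ MeetsEgg W` and, by the previous lemma's
converse use, `Ш(W)[2] ≠ 0` or the tree's frozen-plane case): `#Sel₂(W^{(d)}) = 4·#Ш(W)[2]` for every descent-admissible `d`.  On the first
storey this is `16` with `W^{(d)}(ℚ)[2] = 0`: rank `W^{(d)} ∈ {0, 2, 4}` and a rank-`0` door carries `#Ш(W^{(d)})[2] = 16`, one-door law
`m ≥ v₂(c) + 3` — the I-str class has no depth-two door (census45 prediction P3). -/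
theorem twistSelmerTwoCard_eq_four_mul_shaTwoTorsionCard_of_not_visibleAtInfinity_rankOne (W : WeierstrassCurve ℚ) [W.IsElliptic]
    [W.IsGloballyMinimal] (hΔ : 0 < W.Δ) (hT : NoRationalTwoTorsion W) (hrank : W.mordellWeilRank = 1)
    (hstr : ¬ SelmerTwoVisibleAtInfinity W) {d : ℤ} (hd : DescAdmissible W d) :
    twistSelmerTwoCard W d = 4 * shaTwoTorsionCard W := by
  have h1 := twistSelmerTwoCard_eq_two_mul_selmerTwoCard_of_not_visibleAtInfinity W hΔ hstr hd
  have h2 := selmerTwoCard_eq_two_mul_shaTwoTorsionCard_of_rankOne W hT hrank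
  omega

/-- **THE RESIDUE `R_S` RESTRICTED TO THE FIRST STOREY OF THE DOWN CLASS** (`0 < Δ_W`, `#Ш(W)[2^∞] = 4`, `Sel₂(W)` visible at `∞`):
contains §2's egg storey (`residueShaVisFour` ⟹ `residueShaEggFour` below) and the I-vis identity storey.  Its reduction to the
`SelmerTwoVisibleAtInfinity`-versions of S1′–S3′ is §3's proof verbatim (left to the seat that types them). -/
@[conjecture] def DoorIndexLawFullCAtTwoSomeDoorResidueShaVisFour : Prop :=
  ∀ (W : WeierstrassCurve ℚ) [W.IsElliptic] [W.IsGloballyMinimal] [NeZero (W.conductorNorm ℤ)],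
    ¬ W.HasCM → (∀ n : ℕ, W.HasSurjectiveModNGaloisRep ((2 ^ n : ℕ) : ℤ)) → Odd W.torsionOrder → Odd W.tamagawaProduct →
    W.analyticRank = 1 → 0 < W.Δ → ShaTwoPrimaryCardFour W → SelmerTwoVisibleAtInfinity W → HasLawfulDoorAtTwo W

/-- `R_S ⟹` its DOWN-class first storey (bookkeeping). -/
theorem residueShaVisFour_of_residueSha (h : DoorIndexLawFullCAtTwoSomeDoorResidueSha) :
    DoorIndexLawFullCAtTwoSomeDoorResidueShaVisFour := by
  intro W _ _ _ hCM hsurj htors htam hrank _ h4 _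
  exact h W hCM hsurj htors htam hrank (not_shaTwoTrivial_of_shaTwoPrimaryCardFour W h4)

/-- The DOWN-class storey contains the egg storey of §2 (bookkeeping). -/
theorem residueShaEggFour_of_residueShaVisFour (h : DoorIndexLawFullCAtTwoSomeDoorResidueShaVisFour) :
    DoorIndexLawFullCAtTwoSomeDoorResidueShaEggFour := by
  intro W _ _ _ hCM hsurj htors htam hrank hΔ h4 hegg
  exact h W hCM hsurj htors htam hrank hΔ h4 (selmerTwoVisibleAtInfinity_of_meetsEgg W hegg)

end DownClass

end Summit.BirchSwinnertonDyer.BirchSwinnertonDyer.Theorems.RankOneAtTwoShaSpinAtTwo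

end
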